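import Summits.Ventures.HodgeRepro2.T5BergmanLadder

/-!
# The hyperbolic one-parameter subgroups of `SU(1,1)`

`a_t = su11 (cosh t) (sinh t)` (`T5SU11Cartan.hyp`) and `b_t = su11 (cosh t) (i sinh t)`
(`T5BergmanLadder.hypB`) are one-parameter subgroups: `a_{s+t} = a_s a_t`, `a_0 = 1`, `a_{-t} = a_t⁻¹`
(`hyp_add`, `hyp_zero`, `hyp_neg`) and likewise for `b` (`hypB_add`, `hypB_zero`, `hypB_neg`) — the
addition formulas of `cosh` and `sinh` on the matrix entries.  Together with the rotations
`rot (e^{it})` (a homomorphism `Circle →* SU(1,1)` composed with `Circle.exp`) these are the three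
one-parameter subgroups whose derivatives at `t = 0` give the ladder operators of `T5BergmanLadder`.

Blind lane: Mathlib + the HodgeRepro2 prefix only; no sorry; axioms ⊆ {propext, Classical.choice,
Quot.sound}.
-/

namespace Summit.Ventures.HodgeRepro2.T5SU11OneParameter

open T5PoincareDensity T5SU11Unimodular T5SU11Fibration T5BergmanCoefficient T5SU11Cartan T5BergmanLadder

/-- Two elements of `SU(1,1)` with the same matrix are equal. -/
lemma ext_mat {g h : SU11} (e : mat g = mat h) : g = h := by
  apply Subtype.ext
  apply Subtype.ext
  exact e

/-- The matrix of a product. -/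
lemma mat_mul (g h : SU11) : mat (g * h) = mat g * mat h := by
  show ((((g * h : SU11) : Matrix.SpecialLinearGroup (Fin 2) ℂ)) : Matrix (Fin 2) (Fin 2) ℂ) = _
  rw [Subgroup.coe_mul, Matrix.SpecialLinearGroup.coe_mul]

/-- `su11 a b * su11 c d = su11 (a c + b d̄) (a d + b c̄)`. -/
lemma su11_mul (a b c d : ℂ) :
    su11 a b * su11 c d =
      su11 (a * c + b * (starRingEnd ℂ) d) (a * d + b * (starRingEnd ℂ) c) := by
  ext i j
  fin_cases i <;> fin_cases j <;> simp [su11, Matrix.mul_apply, Fin.sum_univ_two] <;> ring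

/-- **`a_{s+t} = a_s a_t`**: the hyperbolic elements form a one-parameter subgroup. -/
theorem hyp_add (s t : ℝ) : hyp (s + t) = hyp s * hyp t := by
  apply ext_mat
  rw [mat_mul, mat_hyp, mat_hyp, mat_hyp, su11_mul]
  simp only [Complex.conj_ofReal]
  congr 1
  · push_cast
    rw [Complex.cosh_add]
  · push_cast
    rw [Complex.sinh_add]
    ring

/-- `a_0 = 1`. -/
theorem hyp_zero : hyp 0 = 1 := by
  apply ext_mat
  rw [mat_hyp]
  show su11 (Real.cosh 0 : ℂ) (Real.sinh 0 : ℂ) =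
    ((((1 : SU11) : Matrix.SpecialLinearGroup (Fin 2) ℂ)) : Matrix (Fin 2) (Fin 2) ℂ)
  rw [Subgroup.coe_one, Matrix.SpecialLinearGroup.coe_one, Real.cosh_zero, Real.sinh_zero]
  ext i j
  fin_cases i <;> fin_cases j <;> simp [su11]

/-- `a_{-t} = a_t⁻¹`. -/
theorem hyp_neg (t : ℝ) : hyp (-t) = (hyp t)⁻¹ := by
  apply ext_mat
  rw [mat_hyp_inv, mat_hyp, Real.cosh_neg, Real.sinh_neg]
  push_cast
  rfl

/-- **`b_{s+t} = b_s b_t`**. -/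
theorem hypB_add (s t : ℝ) : hypB (s + t) = hypB s * hypB t := by
  apply ext_mat
  rw [mat_mul, mat_hypB, mat_hypB, mat_hypB, su11_mul]
  simp only [map_mul, Complex.conj_I, Complex.conj_ofReal]
  congr 1
  · push_cast
    rw [Complex.cosh_add]
    linear_combination (Complex.sinh (s : ℂ) * Complex.sinh (t : ℂ)) * Complex.I_mul_I
  · push_cast
    rw [Complex.sinh_add]
    ring

/-- `b_0 = 1`. -/
theorem hypB_zero : hypB 0 = 1 := by
  apply ext_mat
  rw [mat_hypB]
  show su11 (Real.cosh 0 : ℂ) (Complex.I * (Real.sinh 0 : ℂ)) =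
    ((((1 : SU11) : Matrix.SpecialLinearGroup (Fin 2) ℂ)) : Matrix (Fin 2) (Fin 2) ℂ)
  rw [Subgroup.coe_one, Matrix.SpecialLinearGroup.coe_one, Real.cosh_zero, Real.sinh_zero]
  ext i j
  fin_cases i <;> fin_cases j <;> simp [su11]

/-- `b_{-t} = b_t⁻¹`. -/
theorem hypB_neg (t : ℝ) : hypB (-t) = (hypB t)⁻¹ := by
  apply ext_mat
  rw [mat_hypB_inv, mat_hypB, Real.cosh_neg, Real.sinh_neg]
  push_cast
  congr 1
  ring

end Summit.Ventures.HodgeRepro2.T5SU11OneParameter
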